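import Literature.RingTheory.FormalGroups.UniversalFormalOModuleLaw
import Literature.RingTheory.FormalGroups.LogarithmPerturbation
import Literature.RingTheory.FormalGroups.CocyclePolynomialFrobenius
import HarnessLib

/-!
# The universal formal `𝒪`-module law, III: how `S_m` enters `F_S` and `[a]_S` in degree `m`
# ([Hazewinkel 1978] §21.4, §5.7; [Drinfeld 1974] §1)

Topic `Literature/RingTheory/FormalGroups`; namespace `Literature.RingTheory.FormalGroups.UnivOModule`.  DEFINITIONS
(`truncK`, `truncR` — the `𝒪`-algebra endomorphisms `S_j ↦ S_j` (`j < m`), `S_j ↦ 0` (`j ≥ m`) —, `topCoeff`, `dirCoeff`) + fully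
proved theorems; no named fact, no instance, no notation, no `sorry`.  Sequel of `UniversalFormalOModuleLaw{Series,}.lean`.
Cell `hodgecm-mathlib`, P6 «MOD programme» sub-line P6d, `stub_L4B3cO`.

THE POINT (for `q ≥ 2`, `m ≥ 2`, `hA : IsLTRing π q`).  The coefficients `a_n` of Hazewinkel's `f_S` only involve the variables
`S_j`, `j ≤ n`, and `S_n` enters `a_n` linearly with coefficient `1` (`n` not a power of `q`) resp. `1/π` (`n = q^i`):

  `τ_m(a_n) = a_n` (`n < m`),   `τ_m(a_m) = a_m − c_m`,  `c_m = S_m` or `S_m/π`     (`logCoeff_truncK_of_lt`, `…_self`)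

where `τ_m` kills `S_j`, `j ≥ m` (`truncK`).  By the degree-`m` perturbation lemma (★ `LogarithmPerturbation.lean`)

  `F_S ≡ τ_{m*} F_S − c_m · B_m (mod deg m+1)`,  `[a]_S ≡ τ_{m*}[a]_S + c_m (a − a^m) X^m (mod deg m+1)`,

`B_m = (X+Y)^m − X^m − Y^m = ν(m)·C_m(X,Y)` (★ `add_pow_eq_add_lazardNu_mul_cocyclePolyEval`).  Descending to `𝒪[S]`:
`c_m B_m = S_m · d_m · C_m` with `d_m = ν(m)` resp. `d_m = p/π` (`dirCoeff`), and for `𝒪`-algebra maps `φ, φ′ : 𝒪[S] → B` which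
agree on `S_j`, `j < m`:  `φ′_* F_S − φ_* F_S ≡ −(φ′ S_m − φ S_m)·d_m·C_m (mod deg m+1)` (`le_order_map_law_sub`), the companion
statement for `[a]_S` (`le_order_map_act_sub`), and `φ′_* F_S ≡ φ_* F_S (mod deg m)` (`le_order_map_law_sub'`).  This is the
«`F_S ≡ X + Y + Σ S_n C_n (mod decomposables)`» of [Hazewinkel1978] (5.7)/(21.4) by which universality is proved degree by degree.

## References
* M. Hazewinkel, *Formal Groups and Applications* (1978), §5.7, §21.4. [Hazewinkel1978]
* V. G. Drinfeld, *Elliptic modules*, Math. USSR-Sb. 23 (1974), §1. [Drinfeld1974]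
-/

noncomputable section

open scoped Classical

namespace Literature.RingTheory.FormalGroups

namespace UnivOModule

open MvPowerSeries Literature.NumberTheory.GaloisRepresentations.LubinTate

universe u v

variable {𝒪 : Type u} [CommRing 𝒪] (π : 𝒪) (q : ℕ)

/-! ## §1 The truncation endomorphisms `τ_m` -/

/-- `τ_m` on `K = 𝒪[1/π][S]`: the `𝒪[1/π]`-algebra endomorphism `S_j ↦ S_j` (`j < m`), `S_j ↦ 0` (`j ≥ m`).
[cite: Hazewinkel1978, §21.4] -/
def truncK (m : ℕ) : KS π →+* KS π :=
  ((MvPolynomial.aeval (fun j : ℕ => if j < m then (MvPolynomial.X j : KS π) else 0) :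
    KS π →ₐ[Localization.Away π] KS π) : KS π →+* KS π)

variable (𝒪) in
/-- `τ_m` on `𝒪[S]`. [cite: Hazewinkel1978, §21.4] -/
def truncR (m : ℕ) : MvPolynomial ℕ 𝒪 →ₐ[𝒪] MvPolynomial ℕ 𝒪 :=
  MvPolynomial.aeval (fun j : ℕ => if j < m then (MvPolynomial.X j : MvPolynomial ℕ 𝒪) else 0)

section Trunc

variable {π q}

/-- `τ_m` fixes constants. [cite: Hazewinkel1978, §21.4] -/
@[simp] theorem truncK_C (m : ℕ) (c : Localization.Away π) : truncK π m (MvPolynomial.C c) = MvPolynomial.C c := by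
  rw [truncK, RingHom.coe_coe, MvPolynomial.aeval_C]; rfl

/-- `τ_m(S_j)`. [cite: Hazewinkel1978, §21.4] -/
@[simp] theorem truncK_X (m j : ℕ) : truncK π m (MvPolynomial.X j) = if j < m then MvPolynomial.X j else 0 := by
  rw [truncK, RingHom.coe_coe, MvPolynomial.aeval_X]

/-- `τ_m` on `𝒪[S]` and on `K` agree along `incl`. [cite: Hazewinkel1978, §21.4] -/
theorem incl_comp_truncR (m : ℕ) : (incl π).comp (truncR 𝒪 m : MvPolynomial ℕ 𝒪 →+* MvPolynomial ℕ 𝒪) =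
    (truncK π m).comp (incl π) := by
  refine MvPolynomial.ringHom_ext (fun a => ?_) (fun j => ?_)
  · rw [RingHom.comp_apply, RingHom.comp_apply, RingHom.coe_coe, truncR, MvPolynomial.aeval_C, incl,
      MvPolynomial.algebraMap_eq, MvPolynomial.map_C, truncK_C]
  · rw [RingHom.comp_apply, RingHom.comp_apply, RingHom.coe_coe, truncR, MvPolynomial.aeval_X, incl, MvPolynomial.map_X,
      truncK_X]
    split_ifs <;> simp

/-- `τ_m` commutes with `σ`. [cite: Hazewinkel1978, §21.4] -/
theorem truncK_comp_frob (m : ℕ) (hq : 1 ≤ q) : (truncK π m).comp (frob π q) = (frob π q).comp (truncK π m) := by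
  refine MvPolynomial.ringHom_ext (fun a => ?_) (fun j => ?_)
  · rw [RingHom.comp_apply, RingHom.comp_apply, frob_C, truncK_C, frob_C]
  · rw [RingHom.comp_apply, RingHom.comp_apply, frob_X, map_pow, truncK_X]
    split_ifs
    · rw [frob_X]
    · rw [map_zero, zero_pow (by omega)]

/-- `τ_m` commutes with `σ^i`. [cite: Hazewinkel1978, §21.4] -/
theorem truncK_frob_pow (m : ℕ) (hq : 1 ≤ q) (i : ℕ) (x : KS π) :
    truncK π m ((frob π q ^ i) x) = (frob π q ^ i) (truncK π m x) := by
  have hbase : ∀ y : KS π, truncK π m (frob π q y) = frob π q (truncK π m y) := fun y => by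
    have := congrArg (fun f => f y) (truncK_comp_frob (π := π) m hq)
    simpa using this
  induction i generalizing x with
  | zero => simp
  | succ i ih =>
    rw [pow_succ, RingHom.coe_mul, Function.comp_apply, Function.comp_apply, ih, hbase]

end Trunc

/-! ## §2 `τ_m` on the coefficients `a_n` of `f_S` -/

/-- The top correction `c_m`: `S_m` if `m` is not a power of `q`, `S_m/π` if it is (`m ≥ 2`). [cite: Hazewinkel1978, §21.4 (21.4.5)] -/
def topCoeff (m : ℕ) : KS π := if IsQPow q m then unifInv π * MvPolynomial.X m else MvPolynomial.X m

section Coeffs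

variable {π q}

/-- **`τ_m(a_n) = a_n` for `n < m`**: `a_n` involves only `S_j`, `j ≤ n`. [cite: Hazewinkel1978, §21.4 (21.4.5)] -/
theorem logCoeff_truncK_of_lt (hq : 2 ≤ q) (m : ℕ) : ∀ n < m, truncK π m (logCoeff π q n) = logCoeff π q n := by
  intro n
  induction n using Nat.strong_induction_on with
  | _ n ih =>
    intro hn
    rcases Nat.eq_zero_or_pos n with rfl | hn0
    · rw [logCoeff_zero, map_zero]
    rw [logCoeff_of_pos hq hn0, map_add, map_sum]
    congr 1
    · unfold gCoeff
      split_ifs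
      · exact map_one _
      · rw [truncK_X, if_pos hn]
      · exact map_zero _
    · refine Finset.sum_congr rfl fun i hi => ?_
      rw [Finset.mem_Icc] at hi
      split_ifs with hdvd
      · have hqi : q ^ i ≤ n := Nat.le_of_dvd hn0 hdvd
        have hlt : n / q ^ i < n := Nat.div_lt_self hn0 (Nat.one_lt_pow (by omega) (by omega))
        rw [map_mul, sCoeff, map_mul, unifInv, truncK_C, truncK_X, if_pos (by omega), truncK_frob_pow m (by omega),
          ih _ hlt (by omega)]
      · exact map_zero _

/-- **`τ_m(a_m) = a_m − c_m`** (`m ≥ 2`): `S_m` enters `a_m` exactly through `g_m = S_m` (`m ∉ q^ℕ`) resp. through the term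
`s_i σ^i(a_1) = S_m/π` with `q^i = m`. [cite: Hazewinkel1978, §21.4 (21.4.5)] -/
theorem logCoeff_truncK_self (hq : 2 ≤ q) {m : ℕ} (hm : 2 ≤ m) :
    truncK π m (logCoeff π q m) = logCoeff π q m - topCoeff π q m := by
  have hq1 : 1 ≤ q := by omega
  rw [logCoeff_of_pos hq (by omega), map_add, map_sum]
  -- the `g_m`-part
  have hg : truncK π m (gCoeff π q m) = 0 := by
    unfold gCoeff
    rw [if_neg (by omega)]
    split_ifs
    · rw [truncK_X, if_neg (lt_irrefl m)]
    · exact map_zero _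
  -- the terms of the sum
  have hterm : ∀ i ∈ Finset.Icc 1 m,
      truncK π m (if q ^ i ∣ m then sCoeff π q i * (frob π q ^ i) (logCoeff π q (m / q ^ i)) else 0) =
        (if q ^ i ∣ m then sCoeff π q i * (frob π q ^ i) (logCoeff π q (m / q ^ i)) else 0) -
          if q ^ i = m then unifInv π * MvPolynomial.X m else 0 := by
    intro i hi
    rw [Finset.mem_Icc] at hi
    by_cases heq : q ^ i = m
    · have hdvd : q ^ i ∣ m := heq ▸ dvd_refl _
      rw [if_pos hdvd, if_pos heq, heq, Nat.div_self (by omega), logCoeff_of_pos hq le_rfl, gCoeff_one,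
        Finset.sum_eq_zero (fun j hj => ?_), add_zero, map_one, mul_one, sCoeff, map_mul, heq, truncK_X,
        if_neg (lt_irrefl m), mul_zero, sub_self]
      · rw [Finset.mem_Icc] at hj
        rw [if_neg]
        intro h1
        have := Nat.le_of_dvd Nat.one_pos h1
        have : q ≤ q ^ j := by
          calc q = q ^ 1 := (pow_one q).symm
            _ ≤ q ^ j := Nat.pow_le_pow_right (by omega) hj.1
        omega
    · rw [if_neg heq, sub_zero]
      split_ifs with hdvd
      · have hqi : q ^ i < m := lt_of_le_of_ne (Nat.le_of_dvd (by omega) hdvd) heq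
        have hlt : m / q ^ i < m := Nat.div_lt_self (by omega) (Nat.one_lt_pow (by omega) (by omega))
        rw [map_mul, sCoeff, map_mul, unifInv, truncK_C, truncK_X, if_pos hqi, truncK_frob_pow m hq1,
          logCoeff_truncK_of_lt hq m _ hlt]
      · exact map_zero _
  rw [Finset.sum_congr rfl hterm, Finset.sum_sub_distrib, hg, zero_add]
  -- the number of `i ∈ [1,m]` with `q^i = m`
  have hcount : (∑ i ∈ Finset.Icc 1 m, if q ^ i = m then unifInv π * MvPolynomial.X m else (0 : KS π)) =
      if IsQPow q m then unifInv π * MvPolynomial.X m else 0 := by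
    by_cases hpow : IsQPow q m
    · have hlog := hpow.2
      have hmem : Nat.log q m ∈ Finset.Icc 1 m := by
        rw [Finset.mem_Icc]
        refine ⟨?_, ?_⟩
        · by_contra h0
          have : Nat.log q m = 0 := by omega
          rw [this, pow_zero] at hlog
          omega
        · calc Nat.log q m ≤ q ^ Nat.log q m := (Nat.lt_pow_self (by omega)).le
            _ = m := hlog
      have hfilt : (Finset.Icc 1 m).filter (fun i => q ^ i = m) = {Nat.log q m} := by
        ext i
        simp only [Finset.mem_filter, Finset.mem_Icc, Finset.mem_singleton]
        constructor
        · rintro ⟨-, hi⟩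
          exact Nat.pow_right_injective hq (hi.trans hlog.symm)
        · rintro rfl
          exact ⟨Finset.mem_Icc.mp hmem, hlog⟩
      rw [if_pos hpow, ← Finset.sum_filter, hfilt, Finset.sum_singleton]
    · rw [if_neg hpow]
      refine Finset.sum_eq_zero fun i hi => ?_
      rw [if_neg]
      intro heq
      apply hpow
      refine ⟨hm, ?_⟩
      rw [← heq, Nat.log_pow (by omega : 1 < q)]
  have hg' : gCoeff π q m = if IsQPow q m then 0 else MvPolynomial.X m := by
    unfold gCoeff
    rw [if_neg (show m ≠ 1 by omega)]
    by_cases h : IsQPow q m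
    · rw [if_pos h, if_neg (fun h' => h'.2 h)]
    · rw [if_neg h, if_pos ⟨hm, h⟩]
  rw [hcount, topCoeff, hg']
  by_cases hpow : IsQPow q m
  · rw [if_pos hpow, if_pos hpow, if_pos hpow]; ring
  · rw [if_neg hpow, if_neg hpow, if_neg hpow]; ring

/-- The coefficients of `f_S` and `τ_{m*} f_S` agree below degree `m`. [cite: Hazewinkel1978, §21.4 (21.4.5)] -/
theorem coeff_logSeries_eq_truncK_of_lt (hq : 2 ≤ q) (m : ℕ) : ∀ i < m, PowerSeries.coeff i (logSeries π q) =
    PowerSeries.coeff i (PowerSeries.map (truncK π m) (logSeries π q)) := by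
  intro i hi
  rw [PowerSeries.coeff_map, coeff_logSeries, logCoeff_truncK_of_lt hq m i hi]

/-- … and differ by `c_m` in degree `m`. [cite: Hazewinkel1978, §21.4 (21.4.5)] -/
theorem coeff_logSeries_eq_truncK_add (hq : 2 ≤ q) {m : ℕ} (hm : 2 ≤ m) : PowerSeries.coeff m (logSeries π q) =
    PowerSeries.coeff m (PowerSeries.map (truncK π m) (logSeries π q)) + topCoeff π q m := by
  rw [PowerSeries.coeff_map, coeff_logSeries, logCoeff_truncK_self hq hm, sub_add_cancel]

end Coeffs

/-! ## §3 `F_S` and `[a]_S` modulo degree `m+1`, over `K` -/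

section OverK

variable {π q}

/-- `F_S ≡ X₀ + X₁ (mod deg 2)` after any base change. [cite: Hazewinkel1978, §21.4 (21.4.8)] -/
private theorem two_le_order_map_lawK (hA : IsLTRing π q) (hq : 2 ≤ q) {B : Type*} [CommRing B] (g : KS π →+* B) :
    ((2 : ℕ) : ℕ∞) ≤ (MvPowerSeries.map g (lawK π q hq) - (X 0 + X 1)).order := by
  have h := formalGroup_two_le_order_sub_X_sub_X (((univLaw π q hA hq).toFormalGroup.map (incl π)).map g)
  rw [FormalGroup.map_toPowerSeries, FormalGroup.map_toPowerSeries, univLaw_toPowerSeries, map_incl_lawInt] at h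
  rw [show MvPowerSeries.map g (lawK π q hq) - (X 0 + X 1) = MvPowerSeries.map g (lawK π q hq) - X 0 - X 1 by ring]
  exact h

/-- **`F_S ≡ τ_{m*}F_S − c_m·B_m (mod deg m+1)`** over `K` (`B_m = (X₀+X₁)^m − X₀^m − X₁^m`).
[cite: Hazewinkel1978, §21.4, §5.7] -/
theorem le_order_lawK_sub_truncK (hA : IsLTRing π q) (hq : 2 ≤ q) {m : ℕ} (hm : 2 ≤ m) :
    ((m + 1 : ℕ) : ℕ∞) ≤ (lawK π q hq - (MvPowerSeries.map (truncK π m) (lawK π q hq) -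
      C (topCoeff π q m) * ((X 0 + X 1) ^ m - X 0 ^ m - X 1 ^ m))).order := by
  have hψ'0 : PowerSeries.constantCoeff (PowerSeries.map (truncK π m) (logSeries π q)) = 0 := by
    rw [← PowerSeries.coeff_zero_eq_constantCoeff_apply, PowerSeries.coeff_map,
      PowerSeries.coeff_zero_eq_constantCoeff_apply, constantCoeff_logSeries, map_zero]
  refine le_order_logLaw_sub_logLaw_add constantCoeff_logSeries (coeff_one_logSeries hq) hm
    (coeff_logSeries_eq_truncK_of_lt hq m) (coeff_logSeries_eq_truncK_add hq hm) (constantCoeff_lawK hq)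
    (by rw [constantCoeff_map, constantCoeff_lawK hq, map_zero]) (two_le_order_map_lawK hA hq _) (logSeries_subst_lawK hq) ?_
  -- `τ_{m*}f_S (τ_{m*}F_S) = τ_{m*}f_S(X₀) + τ_{m*}f_S(X₁)`: push `f_S(F_S) = f_S(X₀) + f_S(X₁)` through `τ_m`
  have h := congrArg (MvPowerSeries.map (truncK π m)) (logSeries_subst_lawK (π := π) hq)
  rw [map_add, PowerSeries.map_subst (PowerSeries.HasSubst.of_constantCoeff_zero (constantCoeff_lawK hq)),
    PowerSeries.map_subst (PowerSeries.HasSubst.X 0), PowerSeries.map_subst (PowerSeries.HasSubst.X 1), map_X, map_X] at h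
  exact h

/-- **`[a]_S ≡ τ_{m*}[a]_S + c_m(a − a^m)X^m (mod deg m+1)`** over `K`, for `a = C(c)` a constant.
[cite: Hazewinkel1978, §21.4, §5.7] -/
theorem le_order_actK_sub_truncK (hq : 2 ≤ q) {m : ℕ} (hm : 2 ≤ m) (c : Localization.Away π) :
    ((m + 1 : ℕ) : ℕ∞) ≤ MvPowerSeries.order (actK π q hq (MvPolynomial.C c) -
      (PowerSeries.map (truncK π m) (actK π q hq (MvPolynomial.C c)) +
        PowerSeries.C (topCoeff π q m * (MvPolynomial.C c - MvPolynomial.C c ^ m)) * PowerSeries.X ^ m) : PowerSeries (KS π)) := by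
  have hh'0 : PowerSeries.constantCoeff (PowerSeries.map (truncK π m) (actK π q hq (MvPolynomial.C c))) = 0 := by
    rw [← PowerSeries.coeff_zero_eq_constantCoeff_apply, PowerSeries.coeff_map,
      PowerSeries.coeff_zero_eq_constantCoeff_apply, constantCoeff_actK hq, map_zero]
  refine le_order_logAct_sub_logAct_sub constantCoeff_logSeries (coeff_one_logSeries hq) hm
    (coeff_logSeries_eq_truncK_of_lt hq m) (coeff_logSeries_eq_truncK_add hq hm) (MvPolynomial.C c)
    (constantCoeff_actK hq _) hh'0 (by rw [PowerSeries.coeff_map, coeff_one_actK π q hq, truncK_C])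
    (logSeries_subst_actK hq _) ?_
  have h := congrArg (MvPowerSeries.map (truncK π m)) (logSeries_subst_actK (π := π) hq (MvPolynomial.C c))
  rw [PowerSeries.map_subst (PowerSeries.HasSubst.of_constantCoeff_zero' (constantCoeff_actK hq _)),
    MvPowerSeries.smul_eq_C_mul, map_mul, MvPowerSeries.map_C, truncK_C, ← MvPowerSeries.smul_eq_C_mul] at h
  exact h

end OverK

/-! ## §4 Descent to `𝒪[S]` and base change -/

/-- The `𝒪`-coefficient `d_m` of the degree-`m` direction: `ν(m)` if `m` is not a power of `q`, and `p/π` (the chosen `w` with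
`p = π·w` from `IsLTRing`) if it is; so that `c_m · B_m = S_m · d_m · C_m(X,Y)`. [cite: Hazewinkel1978, §21.4] -/
def dirCoeff (hA : IsLTRing π q) (m : ℕ) : 𝒪 :=
  if IsQPow q m then (Ideal.mem_span_singleton'.mp hA.exists_prime.choose_spec.choose_spec.2.2).choose else lazardNu m

section Descent

variable {π q}

/-- `π · (p/π) = p` for the chosen prime of `IsLTRing`. [cite: Hazewinkel1978, §21.4] -/
theorem dirCoeff_spec_of_isQPow (hA : IsLTRing π q) {m : ℕ} (hm : IsQPow q m) :
    (Ideal.mem_span_singleton'.mp hA.exists_prime.choose_spec.choose_spec.2.2).choose * π =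
      (hA.exists_prime.choose : 𝒪) ∧ dirCoeff π q hA m =
      (Ideal.mem_span_singleton'.mp hA.exists_prime.choose_spec.choose_spec.2.2).choose := by
  refine ⟨(Ideal.mem_span_singleton'.mp hA.exists_prime.choose_spec.choose_spec.2.2).choose_spec, ?_⟩
  rw [dirCoeff, if_pos hm]

/-- For `m = q^i` (`i ≥ 1`), `ν(m)` is the residue characteristic `p` of `IsLTRing`. [cite: Lazard1955, §II Lemme 3] -/
theorem lazardNu_eq_of_isQPow (hA : IsLTRing π q) (hq : 2 ≤ q) {m : ℕ} (hm : IsQPow q m) :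
    lazardNu m = hA.exists_prime.choose := by
  obtain ⟨hp, hqpr, -⟩ := hA.exists_prime.choose_spec.choose_spec
  set p := hA.exists_prime.choose
  set r := hA.exists_prime.choose_spec.choose
  obtain ⟨hm2, hlog⟩ := hm
  have hr : 0 < r := by
    rcases Nat.eq_zero_or_pos r with h | h
    · rw [h, pow_zero] at hqpr; omega
    · exact h
  have hl : 0 < Nat.log q m := by
    by_contra h0
    have : Nat.log q m = 0 := by omega
    rw [this, pow_zero] at hlog; omega
  have hm' : m = p ^ (r * Nat.log q m) := by rw [pow_mul, ← hqpr, hlog]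
  rw [hm']
  exact lazardNu_prime_pow hp (Nat.mul_pos hr hl)

/-- **`c_m · B_m = incl(S_m · d_m) · C_m(X₀,X₁)`** in `K⟦X₀,X₁⟧`. [cite: Hazewinkel1978, §21.4] -/
theorem C_topCoeff_mul_eq (hA : IsLTRing π q) (hq : 2 ≤ q) {m : ℕ} (hm : 2 ≤ m) :
    C (topCoeff π q m) * ((X 0 + X 1) ^ m - X 0 ^ m - X 1 ^ m : MvPowerSeries (Fin 2) (KS π)) =
      C (incl π (MvPolynomial.X m * MvPolynomial.C (dirCoeff π q hA m))) *
        cocyclePolyEval (MvPowerSeries (Fin 2) (KS π)) m (X 0) (X 1) := by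
  rw [add_pow_eq_add_lazardNu_mul_cocyclePolyEval (by omega : 0 < m), show ∀ x y z : MvPowerSeries (Fin 2) (KS π),
    x + y + z - x - y = z from fun x y z => by ring, ← mul_assoc, ← map_natCast (C (σ := Fin 2) (R := KS π)), ← map_mul]
  congr 2
  rw [map_mul, incl, MvPolynomial.map_X, MvPolynomial.map_C, topCoeff]
  by_cases hpow : IsQPow q m
  · obtain ⟨hwp, hd⟩ := dirCoeff_spec_of_isQPow (π := π) hA hpow
    have hnat : ((lazardNu m : ℕ) : KS π) =
        MvPolynomial.C (algebraMap 𝒪 (Localization.Away π) (dirCoeff π q hA m)) * unif π := by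
      rw [lazardNu_eq_of_isQPow hA hq hpow, unif, ← map_mul, ← map_mul, hd, hwp, map_natCast, map_natCast]
    rw [if_pos hpow, hnat]
    calc unifInv π * MvPolynomial.X m * (MvPolynomial.C _ * unif π)
        = MvPolynomial.X m * MvPolynomial.C _ * (unif π * unifInv π) := by ring
      _ = _ := by rw [unif_mul_unifInv, mul_one]
  · rw [if_neg hpow, dirCoeff, if_neg hpow, map_natCast, map_natCast]

/-- Injective ring maps do not lower the order of a series. [folklore] -/
private theorem le_order_of_map {R S : Type*} [CommRing R] [CommRing S] {σ : Type*} {f : R →+* S}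
    (hf : Function.Injective f) {N : ℕ} {x : MvPowerSeries σ R} (h : (N : ℕ∞) ≤ (MvPowerSeries.map f x).order) :
    (N : ℕ∞) ≤ x.order := by
  rw [natCast_le_order_iff] at h ⊢
  intro d hd
  apply hf
  rw [← coeff_map, h d hd, map_zero]

/-- Ring maps do not lower the order of a series. [folklore] -/
private theorem le_order_map_of_le {R S : Type*} [CommRing R] [CommRing S] {σ : Type*} (f : R →+* S)
    {N : ℕ} {x : MvPowerSeries σ R} (h : (N : ℕ∞) ≤ x.order) : (N : ℕ∞) ≤ (MvPowerSeries.map f x).order :=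
  h.trans (le_order_map f)

/-- **`F_S ≡ τ_{m*}F_S − S_m·d_m·C_m (mod deg m+1)` over `𝒪[S]`.** [cite: Hazewinkel1978, §21.4] -/
theorem le_order_lawInt_sub_truncR (hA : IsLTRing π q) (hq : 2 ≤ q) {m : ℕ} (hm : 2 ≤ m) :
    ((m + 1 : ℕ) : ℕ∞) ≤ (lawInt π q hA hq - (MvPowerSeries.map (truncR 𝒪 m : MvPolynomial ℕ 𝒪 →+* MvPolynomial ℕ 𝒪)
      (lawInt π q hA hq) - C (MvPolynomial.X m * MvPolynomial.C (dirCoeff π q hA m)) *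
        cocyclePolyEval (MvPowerSeries (Fin 2) (MvPolynomial ℕ 𝒪)) m (X 0) (X 1))).order := by
  apply le_order_of_map (incl_injective hA)
  have h := le_order_lawK_sub_truncK hA hq hm
  rw [C_topCoeff_mul_eq hA hq hm, ← map_incl_lawInt hA hq, map_map, ← incl_comp_truncR, ← map_map] at h
  rw [map_sub, map_sub, map_mul, map_C, map_cocyclePolyEval, map_X, map_X]
  exact h

/-- **`[a]_S ≡ τ_{m*}[a]_S + S_m·d'_m(a)·X^m (mod deg m+1)` over `𝒪[S]`**, where `π·d'_m(a) = (p/π)·… `; precisely: with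
`e := a − a^m`, the correction is `S_m · e` (`m ∉ q^ℕ`) and `S_m · e/π` (`m ∈ q^ℕ`), packaged as: for every `e' ∈ 𝒪` with
`incl(S_m · e') = c_m (a − a^m)`. We state it with the `K`-side correction pulled back along `incl` coefficientwise.
[cite: Hazewinkel1978, §21.4] -/
theorem le_order_actInt_sub_truncR (hA : IsLTRing π q) (hq : 2 ≤ q) {m : ℕ} (hm : 2 ≤ m) (a e : 𝒪)
    (he : incl π (MvPolynomial.X m * MvPolynomial.C e) =
      topCoeff π q m * (MvPolynomial.C (algebraMap 𝒪 _ a) - MvPolynomial.C (algebraMap 𝒪 _ a) ^ m)) :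
    ((m + 1 : ℕ) : ℕ∞) ≤ MvPowerSeries.order (actInt π q hA hq a -
      (PowerSeries.map (truncR 𝒪 m : MvPolynomial ℕ 𝒪 →+* MvPolynomial ℕ 𝒪) (actInt π q hA hq a) +
        PowerSeries.C (MvPolynomial.X m * MvPolynomial.C e) * PowerSeries.X ^ m) : PowerSeries (MvPolynomial ℕ 𝒪)) := by
  apply le_order_of_map (σ := Unit) (incl_injective hA)
  have h := le_order_actK_sub_truncK (π := π) hq hm (algebraMap 𝒪 (Localization.Away π) a)
  rw [← he, ← map_incl_actInt hA hq] at h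
  change ((m + 1 : ℕ) : ℕ∞) ≤ MvPowerSeries.order (PowerSeries.map (incl π) _)
  rw [map_sub, map_add, map_mul, PowerSeries.map_C, map_pow, PowerSeries.map_X, ← RingHom.comp_apply (PowerSeries.map (incl π)),
    ← PowerSeries.map_comp, incl_comp_truncR, PowerSeries.map_comp, RingHom.comp_apply]
  exact h

/-- The element `e'` of the previous statement exists: `a − a^m = π·e` when `m` is a power of `q` (then `e' = (p/π)⁻¹…`) —
concretely, for `m ∈ q^ℕ` we have `π ∣ a^m − a` and `e' = (a − a^m)/π`; for `m ∉ q^ℕ`, `e' = a − a^m`.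
[cite: Hazewinkel1978, §21.4] -/
theorem exists_actDir (hA : IsLTRing π q) (m : ℕ) (a : 𝒪) :
    ∃ e : 𝒪, (if IsQPow q m then π * e = a - a ^ m else e = a - a ^ m) ∧
      incl π (MvPolynomial.X m * MvPolynomial.C e) =
        topCoeff π q m * (MvPolynomial.C (algebraMap 𝒪 _ a) - MvPolynomial.C (algebraMap 𝒪 _ a) ^ m) := by
  by_cases hpow : IsQPow q m
  · -- `π ∣ a^m − a` since `a^q ≡ a (mod π)` and `m = q^i`
    obtain ⟨hm2, hlog⟩ := hpow
    have hdvd : ∀ i : ℕ, π ∣ a ^ (q ^ i) - a := by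
      intro i
      induction i with
      | zero => simp
      | succ i ih =>
        have h1 : π ∣ (a ^ (q ^ i)) ^ q - a ^ (q ^ i) := hA.dvd_pow_sub _
        rw [pow_succ, pow_mul]
        have := dvd_add h1 ih
        rwa [sub_add_sub_cancel] at this
    obtain ⟨e, he⟩ := (dvd_neg.mpr (hdvd (Nat.log q m)))
    rw [hlog, neg_sub] at he
    refine ⟨e, by rw [if_pos ⟨hm2, hlog⟩]; exact he.symm, ?_⟩
    rw [topCoeff, if_pos ⟨hm2, hlog⟩, map_mul, incl, MvPolynomial.map_X, MvPolynomial.map_C, ← map_pow, ← map_sub,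
      ← map_pow, ← map_sub, he, map_mul, map_mul]
    change _ = unifInv π * MvPolynomial.X m * (unif π * MvPolynomial.C _)
    calc MvPolynomial.X m * MvPolynomial.C ((algebraMap 𝒪 (Localization.Away π)) e)
        = MvPolynomial.X m * MvPolynomial.C _ * (unif π * unifInv π) := by rw [unif_mul_unifInv, mul_one]
      _ = _ := by ring
  · refine ⟨a - a ^ m, by rw [if_neg hpow], ?_⟩
    rw [topCoeff, if_neg hpow, map_mul, incl, MvPolynomial.map_X, MvPolynomial.map_C, map_sub, map_pow, map_sub, map_pow]

end Descent

/-! ## §5 Base change: how `φ(S_m)` enters `φ_* F_S`, `φ_* [a]_S` -/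

section BaseChange

variable {π q} {B : Type v} [CommRing B] [Algebra 𝒪 B]

/-- Two `𝒪`-algebra maps `𝒪[S] → B` agreeing on `S_j`, `j < m`, agree after `τ_m`. [cite: Hazewinkel1978, §21.4] -/
theorem comp_truncR_eq (m : ℕ) {φ φ' : MvPolynomial ℕ 𝒪 →ₐ[𝒪] B} (h : ∀ j < m, φ (MvPolynomial.X j) = φ' (MvPolynomial.X j)) :
    (φ : MvPolynomial ℕ 𝒪 →+* B).comp (truncR 𝒪 m : MvPolynomial ℕ 𝒪 →+* MvPolynomial ℕ 𝒪) =
      (φ' : MvPolynomial ℕ 𝒪 →+* B).comp (truncR 𝒪 m : MvPolynomial ℕ 𝒪 →+* MvPolynomial ℕ 𝒪) := by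
  refine MvPolynomial.ringHom_ext (fun a => ?_) (fun j => ?_)
  · simp only [RingHom.comp_apply, RingHom.coe_coe, truncR, MvPolynomial.aeval_C, MvPolynomial.algebraMap_eq]
    rw [← MvPolynomial.algebraMap_eq]
    simp only [AlgHom.commutes]
  · simp only [RingHom.comp_apply, RingHom.coe_coe, truncR, MvPolynomial.aeval_X]
    split_ifs with hj
    · exact h j hj
    · rw [map_zero, map_zero]

/-- **How `φ(S_m)` enters `φ_* F_S` in degree `m`:** for `𝒪`-algebra maps `φ, φ′ : 𝒪[S] → B` agreeing on `S_j` (`j < m`),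
`φ′_* F_S − φ_* F_S ≡ −(φ′(S_m) − φ(S_m)) · d_m · C_m(X₀,X₁) (mod deg m+1)`. [cite: Hazewinkel1978, §21.4] -/
theorem le_order_map_law_sub (hA : IsLTRing π q) (hq : 2 ≤ q) {m : ℕ} (hm : 2 ≤ m)
    {φ φ' : MvPolynomial ℕ 𝒪 →ₐ[𝒪] B} (h : ∀ j < m, φ (MvPolynomial.X j) = φ' (MvPolynomial.X j)) :
    ((m + 1 : ℕ) : ℕ∞) ≤ (MvPowerSeries.map (φ' : MvPolynomial ℕ 𝒪 →+* B) (lawInt π q hA hq) -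
      MvPowerSeries.map (φ : MvPolynomial ℕ 𝒪 →+* B) (lawInt π q hA hq) +
      C ((φ' (MvPolynomial.X m) - φ (MvPolynomial.X m)) * algebraMap 𝒪 B (dirCoeff π q hA m)) *
        cocyclePolyEval (MvPowerSeries (Fin 2) B) m (X 0) (X 1)).order := by
  have key : ∀ χ : MvPolynomial ℕ 𝒪 →ₐ[𝒪] B, ((m + 1 : ℕ) : ℕ∞) ≤
      (MvPowerSeries.map (χ : MvPolynomial ℕ 𝒪 →+* B) (lawInt π q hA hq) -
        (MvPowerSeries.map ((χ : MvPolynomial ℕ 𝒪 →+* B).comp (truncR 𝒪 m : MvPolynomial ℕ 𝒪 →+* MvPolynomial ℕ 𝒪))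
          (lawInt π q hA hq) - C (χ (MvPolynomial.X m) * algebraMap 𝒪 B (dirCoeff π q hA m)) *
            cocyclePolyEval (MvPowerSeries (Fin 2) B) m (X 0) (X 1))).order := by
    intro χ
    have h1 := le_order_map_of_le (χ : MvPolynomial ℕ 𝒪 →+* B) (le_order_lawInt_sub_truncR hA hq hm)
    rw [map_sub, map_sub, map_map, map_mul, map_C, map_cocyclePolyEval, map_X, map_X, RingHom.coe_coe, map_mul,
      ← MvPolynomial.algebraMap_eq, AlgHom.commutes] at h1
    exact h1
  have h1 := key φ
  have h2 := key φ'
  rw [comp_truncR_eq m h] at h1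
  have e : MvPowerSeries.map (φ' : MvPolynomial ℕ 𝒪 →+* B) (lawInt π q hA hq) -
      MvPowerSeries.map (φ : MvPolynomial ℕ 𝒪 →+* B) (lawInt π q hA hq) +
      C ((φ' (MvPolynomial.X m) - φ (MvPolynomial.X m)) * algebraMap 𝒪 B (dirCoeff π q hA m)) *
        cocyclePolyEval (MvPowerSeries (Fin 2) B) m (X 0) (X 1) =
      (MvPowerSeries.map (φ' : MvPolynomial ℕ 𝒪 →+* B) (lawInt π q hA hq) -
        (MvPowerSeries.map ((φ' : MvPolynomial ℕ 𝒪 →+* B).comp (truncR 𝒪 m : MvPolynomial ℕ 𝒪 →+* MvPolynomial ℕ 𝒪))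
          (lawInt π q hA hq) - C (φ' (MvPolynomial.X m) * algebraMap 𝒪 B (dirCoeff π q hA m)) *
            cocyclePolyEval (MvPowerSeries (Fin 2) B) m (X 0) (X 1))) -
      (MvPowerSeries.map (φ : MvPolynomial ℕ 𝒪 →+* B) (lawInt π q hA hq) -
        (MvPowerSeries.map ((φ' : MvPolynomial ℕ 𝒪 →+* B).comp (truncR 𝒪 m : MvPolynomial ℕ 𝒪 →+* MvPolynomial ℕ 𝒪))
          (lawInt π q hA hq) - C (φ (MvPolynomial.X m) * algebraMap 𝒪 B (dirCoeff π q hA m)) *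
            cocyclePolyEval (MvPowerSeries (Fin 2) B) m (X 0) (X 1))) := by
    rw [sub_mul, map_sub (C (σ := Fin 2) (R := B)), sub_mul]
    ring
  rw [e]
  exact natCast_le_order_sub h2 h1

/-- **Below degree `m`, `φ_* F_S` only depends on `φ(S_j)`, `j < m`.** [cite: Hazewinkel1978, §21.4] -/
theorem le_order_map_law_sub' (hA : IsLTRing π q) (hq : 2 ≤ q) {m : ℕ} (hm : 2 ≤ m)
    {φ φ' : MvPolynomial ℕ 𝒪 →ₐ[𝒪] B} (h : ∀ j < m, φ (MvPolynomial.X j) = φ' (MvPolynomial.X j)) :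
    (m : ℕ∞) ≤ (MvPowerSeries.map (φ' : MvPolynomial ℕ 𝒪 →+* B) (lawInt π q hA hq) -
      MvPowerSeries.map (φ : MvPolynomial ℕ 𝒪 →+* B) (lawInt π q hA hq)).order := by
  have h1 := le_order_map_law_sub hA hq hm h
  have hC : (m : ℕ∞) ≤ (C ((φ' (MvPolynomial.X m) - φ (MvPolynomial.X m)) * algebraMap 𝒪 B (dirCoeff π q hA m)) *
      cocyclePolyEval (MvPowerSeries (Fin 2) B) m (X 0) (X 1)).order := by
    apply natCast_le_order_mul_left
    unfold cocyclePolyEval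
    refine natCast_le_order_sum _ fun j hj => ?_
    rw [Finset.mem_range] at hj
    have e : ((cocycleCoeff m j : ℕ) : MvPowerSeries (Fin 2) B) * X 0 ^ j * X 1 ^ (m - j) =
        C ((cocycleCoeff m j : ℕ) : B) * (X 0 ^ j * X 1 ^ (m - j)) := by rw [map_natCast, mul_assoc]
    rw [e]
    apply natCast_le_order_mul_left
    have h0 : (j : ℕ∞) ≤ ((X 0 : MvPowerSeries (Fin 2) B) ^ j).order := le_order_pow_of_constantCoeff_eq_zero j (constantCoeff_X 0)
    have h1' : ((m - j : ℕ) : ℕ∞) ≤ ((X 1 : MvPowerSeries (Fin 2) B) ^ (m - j)).order :=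
      le_order_pow_of_constantCoeff_eq_zero _ (constantCoeff_X 1)
    have := natCast_add_le_order_mul h0 h1'
    rwa [show j + (m - j) = m by omega] at this
  have := natCast_le_order_sub (natCast_le_order_of_le h1 (by omega : m ≤ m + 1)) hC
  rwa [add_sub_cancel_right] at this

/-- **How `φ(S_m)` enters `φ_* [a]_S` in degree `m`:** with `e ∈ 𝒪` the action direction of `exists_actDir` (`e = a − a^m` or
`(a − a^m)/π`), `φ′_*[a]_S − φ_*[a]_S ≡ (φ′(S_m) − φ(S_m)) · e · X^m (mod deg m+1)`. [cite: Hazewinkel1978, §21.4] -/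
theorem le_order_map_act_sub (hA : IsLTRing π q) (hq : 2 ≤ q) {m : ℕ} (hm : 2 ≤ m) (a e : 𝒪)
    (he : incl π (MvPolynomial.X m * MvPolynomial.C e) =
      topCoeff π q m * (MvPolynomial.C (algebraMap 𝒪 _ a) - MvPolynomial.C (algebraMap 𝒪 _ a) ^ m))
    {φ φ' : MvPolynomial ℕ 𝒪 →ₐ[𝒪] B} (h : ∀ j < m, φ (MvPolynomial.X j) = φ' (MvPolynomial.X j)) :
    ((m + 1 : ℕ) : ℕ∞) ≤ MvPowerSeries.order (PowerSeries.map (φ' : MvPolynomial ℕ 𝒪 →+* B) (actInt π q hA hq a) -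
      PowerSeries.map (φ : MvPolynomial ℕ 𝒪 →+* B) (actInt π q hA hq a) -
      PowerSeries.C ((φ' (MvPolynomial.X m) - φ (MvPolynomial.X m)) * algebraMap 𝒪 B e) * PowerSeries.X ^ m :
        PowerSeries B) := by
  have key : ∀ χ : MvPolynomial ℕ 𝒪 →ₐ[𝒪] B, ((m + 1 : ℕ) : ℕ∞) ≤ MvPowerSeries.order
      (PowerSeries.map (χ : MvPolynomial ℕ 𝒪 →+* B) (actInt π q hA hq a) -
        (PowerSeries.map ((χ : MvPolynomial ℕ 𝒪 →+* B).comp (truncR 𝒪 m : MvPolynomial ℕ 𝒪 →+* MvPolynomial ℕ 𝒪))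
          (actInt π q hA hq a) + PowerSeries.C (χ (MvPolynomial.X m) * algebraMap 𝒪 B e) * PowerSeries.X ^ m) :
        PowerSeries B) := by
    intro χ
    have h1 := le_order_map_of_le (σ := Unit) (χ : MvPolynomial ℕ 𝒪 →+* B) (le_order_actInt_sub_truncR hA hq hm a e he)
    have e1 : MvPowerSeries.map (χ : MvPolynomial ℕ 𝒪 →+* B) (actInt π q hA hq a -
        (PowerSeries.map (truncR 𝒪 m : MvPolynomial ℕ 𝒪 →+* MvPolynomial ℕ 𝒪) (actInt π q hA hq a) +
          PowerSeries.C (MvPolynomial.X m * MvPolynomial.C e) * PowerSeries.X ^ m) : PowerSeries (MvPolynomial ℕ 𝒪)) =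
        (PowerSeries.map (χ : MvPolynomial ℕ 𝒪 →+* B) (actInt π q hA hq a) -
          (PowerSeries.map ((χ : MvPolynomial ℕ 𝒪 →+* B).comp (truncR 𝒪 m : MvPolynomial ℕ 𝒪 →+* MvPolynomial ℕ 𝒪))
            (actInt π q hA hq a) + PowerSeries.C (χ (MvPolynomial.X m) * algebraMap 𝒪 B e) * PowerSeries.X ^ m) :
          PowerSeries B) := by
      change PowerSeries.map (χ : MvPolynomial ℕ 𝒪 →+* B) _ = _
      rw [map_sub, map_add, map_mul, PowerSeries.map_C, map_pow, PowerSeries.map_X,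
        ← RingHom.comp_apply (PowerSeries.map (χ : MvPolynomial ℕ 𝒪 →+* B)), ← PowerSeries.map_comp, RingHom.coe_coe,
        map_mul, ← MvPolynomial.algebraMap_eq, AlgHom.commutes]
    rw [e1] at h1
    exact h1
  have h1 := key φ
  have h2 := key φ'
  rw [comp_truncR_eq m h] at h1
  have e2 : (PowerSeries.map (φ' : MvPolynomial ℕ 𝒪 →+* B) (actInt π q hA hq a) -
      PowerSeries.map (φ : MvPolynomial ℕ 𝒪 →+* B) (actInt π q hA hq a) -
      PowerSeries.C ((φ' (MvPolynomial.X m) - φ (MvPolynomial.X m)) * algebraMap 𝒪 B e) * PowerSeries.X ^ m :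
        PowerSeries B) =
      (PowerSeries.map (φ' : MvPolynomial ℕ 𝒪 →+* B) (actInt π q hA hq a) -
        (PowerSeries.map ((φ' : MvPolynomial ℕ 𝒪 →+* B).comp (truncR 𝒪 m : MvPolynomial ℕ 𝒪 →+* MvPolynomial ℕ 𝒪))
          (actInt π q hA hq a) + PowerSeries.C (φ' (MvPolynomial.X m) * algebraMap 𝒪 B e) * PowerSeries.X ^ m)) -
      (PowerSeries.map (φ : MvPolynomial ℕ 𝒪 →+* B) (actInt π q hA hq a) -
        (PowerSeries.map ((φ' : MvPolynomial ℕ 𝒪 →+* B).comp (truncR 𝒪 m : MvPolynomial ℕ 𝒪 →+* MvPolynomial ℕ 𝒪))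
          (actInt π q hA hq a) + PowerSeries.C (φ (MvPolynomial.X m) * algebraMap 𝒪 B e) * PowerSeries.X ^ m)) := by
    rw [sub_mul, map_sub PowerSeries.C, sub_mul]
    ring
  rw [e2]
  exact natCast_le_order_sub h2 h1

/-- **Below degree `m`, `φ_* [a]_S` only depends on `φ(S_j)`, `j < m`.** [cite: Hazewinkel1978, §21.4] -/
theorem le_order_map_act_sub' (hA : IsLTRing π q) (hq : 2 ≤ q) {m : ℕ} (hm : 2 ≤ m) (a : 𝒪)
    {φ φ' : MvPolynomial ℕ 𝒪 →ₐ[𝒪] B} (h : ∀ j < m, φ (MvPolynomial.X j) = φ' (MvPolynomial.X j)) :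
    (m : ℕ∞) ≤ MvPowerSeries.order (PowerSeries.map (φ' : MvPolynomial ℕ 𝒪 →+* B) (actInt π q hA hq a) -
      PowerSeries.map (φ : MvPolynomial ℕ 𝒪 →+* B) (actInt π q hA hq a) : PowerSeries B) := by
  obtain ⟨e, -, he⟩ := exists_actDir (π := π) hA m a
  have h1 := le_order_map_act_sub hA hq hm a e he h
  have hE : (m : ℕ∞) ≤ MvPowerSeries.order
      (PowerSeries.C ((φ' (MvPolynomial.X m) - φ (MvPolynomial.X m)) * algebraMap 𝒪 B e) * PowerSeries.X ^ m :
        PowerSeries B) := by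
    apply natCast_le_order_of_coeff_eq_zero
    intro i hi
    rw [PowerSeries.coeff_C_mul, PowerSeries.coeff_X_pow, if_neg hi.ne, mul_zero]
  have := natCast_le_order_add (natCast_le_order_of_le h1 (by omega : m ≤ m + 1)) hE
  rwa [sub_add_cancel] at this

end BaseChange

end UnivOModule

end Literature.RingTheory.FormalGroups
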